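import Literature.NumberTheory.Automorphic.ReciprocityGLnProofs
import Literature.NumberTheory.GaloisRepresentations.PstWeilDeligne
import Literature.NumberTheory.GaloisRepresentations.LabelledHodgeTateWeights
import Literature.NumberTheory.Automorphic.AdicCompletionLocalField
import HarnessLib

/-!
# A'Campo–Hevesi–Thorne–Whitmore 2026, Thm. 1.2.1: `r_{π,ι}` is de Rham with regular Hodge–Tate
# weights at the places above `p`, for regular algebraic cuspidal `π` on `GL_n` over a CM field

Topic `NumberTheory/Automorphic` (vocabulary of `ReciprocityGLnProofs`:
`CuspidalAutomorphicRepData`, `IsRegularAlgebraic`, `HarrisLanTaylorThorne2016.IsCompatible`; of the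
Galois-representation files: `FramedGaloisRep`, `toLocal`, `PstWeilDeligneData.IsDeRhamFramed`
(`PstWeilDeligne`), `FramedGaloisRep.labelledHodgeTateWeightsAt` (`LabelledHodgeTateWeights`)).

L. A'Campo, B. Hevesi, J. A. Thorne, D. Whitmore, *Local-global compatibility of automorphic Galois
representations over CM fields at `p`*, arXiv:2607.11763 (2026), **Theorem 1.2.1** (p. 5 of the held
text, read 2026-08-16), as printed:

> 1.2.1. Theorem. Let `F` be a CM number field, let `n ≥ 1`, and let `ι : ℚ̄_p → ℂ` be an
> isomorphism. Let `π` be a cuspidal, regular algebraic automorphic representation of `GL_n(𝔸_F)` of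
> weight `λ`. Then for any place `v | p` of `F`, the representation `r_{π,ι}|_{G_{F_v}}` is de Rham of
> Hodge–Tate weights `HT_τ(r_{π,ι}) = {λ_{ιτ,1} + (n−1), λ_{ιτ,2} + (n−2), …, λ_{ιτ,n}}`, and there
> is an isomorphism `WD(r_{π,ι}|_{G_{F_v}})^{ss} ≅ ι⁻¹ rec^T_{F_v}(π_v)^{ss}`.

(§1.2: "We complete the proof of Conjecture 1.1.3 for CM number fields `F`, by establishing
semi-simplified local-global compatibility at the `p`-adic places"; here `r_{π,ι}` is the
representation of Harris–Lan–Taylor–Thorne / Scholze, `λ = (λ_τ)_τ` a dominant weight,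
`λ_{τ,1} ≥ … ≥ λ_{τ,n}`, so the `n` printed Hodge–Tate numbers at each `τ` are PAIRWISE DISTINCT.)

NAMED FACT (D-0014): the proof (degree shifting on `U(n,n)` without global hypotheses) is far out of
reach of the library.  It grounds — as an input, not as the item — the cruxes
`Summit.Langlands.Langlands.Theses.OrdinaryPrimeTransport.PrimeRankTransport` (Hodge–Tate regularity
of the avatars of `π` at one prime) and `….SummandsPotentiallyAutomorphic` (de Rham-ness of the
avatars at `v ∣ ℓ₀`, an hypothesis of `Qian2022.potentialAutomorphy_ordinary`) of route
`OrdinaryPrimeTransport`.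

## Rendering (WEAKER than the source, never stronger)

* `r_{π,ι}` is, by definition (HLTT Thm. A), the unique continuous semisimple representation with
  HLTT's characterising property; as in the accepted `Varma2024.corollary93_unramified` the fact is
  stated for EVERY continuous semisimple `r : Γ_K →ₜ* GL_n(ℚ̄_ℓ)` with that property
  (`HarrisLanTaylorThorne2016.IsCompatible π ι r`), all of which are `GL_n(ℚ̄_ℓ)`-conjugate to
  `r_{π,ι}` (HLTT Thm. A uniqueness + Brauer–Nesbitt), de Rham-ness and Hodge–Tate weights being
  conjugation invariants.
* "de Rham at `v ∣ ℓ`" is `(𝓓 K ℓ v hv).IsDeRhamFramed (r.toLocal v)` relative to `p`-adic Hodge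
  data `𝓓` — a PARAMETER, exactly as in the accepted `Qian2022.potentialAutomorphy_ordinary` and
  `FontaineMazurLanglandsGLn 𝔅` (Lean has no `B_dR`; the printed theorem is the member of the family
  at the genuine datum, see the module docstring of `Qian2022PotentialAutomorphy`).
* Of the Hodge–Tate clause only its consequence "the `τ`-labelled Hodge–Tate weights are
  multiplicity-free for every CONTINUOUS label `τ : K_v → ℚ̄_ℓ`" is vendored
  (`(r.labelledHodgeTateWeightsAt v alg 𝔅 τ).Nodup`, the tree's `HT_τ`, Patrikis' formalism); the
  exact values `λ_{ιτ,j} + n − j` would need the weight `λ` of `π` as a typed function of the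
  embeddings `K → ℂ`, which the tree's `IsRegularAlgebraic` does not expose.  Distinctness is
  insensitive to the sign convention for `HT(ε)`.
* The Weil–Deligne clause `WD(…)^{ss} ≅ ι⁻¹rec^T(π_v)^{ss}` is NOT vendored (no `rec` for ramified
  `π_v` in the tree); dropping a conclusion only weakens the statement.
* `1 ≤ n` as printed; `K` CM (`NumberField.IsCMField`).

## References

* [AHTW2026] L. A'Campo, B. Hevesi, J. A. Thorne, D. Whitmore, *Local-global compatibility of
  automorphic Galois representations over CM fields at p*, arXiv:2607.11763, Thm. 1.2.1 (p. 5).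
* [HarrisLanTaylorThorneRMS2016] M. Harris, K.-W. Lan, R. Taylor, J. Thorne, Res. Math. Sci. 3:37
  (2016), Thm. A (`r_{ℓ,ι}(π)`).
* [Patrikis2019] S. Patrikis, *Variations on a theorem of Tate*, Mem. AMS 258 (2019), §2.3.1, §2.7.1
  (labelled Hodge–Tate weights, "regular").
-/

noncomputable section

open scoped NumberField
open NumberField IsDedekindDomain Filter
open Literature.NumberTheory.GaloisRepresentations

namespace Literature.NumberTheory.Automorphic

namespace AHTW2026

/-- **A'Campo–Hevesi–Thorne–Whitmore 2026, Theorem 1.2.1 (de Rham and Hodge–Tate-regular clause)**,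
NAMED FACT, relative to `p`-adic Hodge data `𝓓 K p v` at the places `v ∣ p` of number fields
(intended: `B_dR(K_v)` with `WD ∘ D_pst`; a parameter, see the module docstring).  For every CM
number field `K`, every `n ≥ 1`, every cuspidal regular algebraic `π` on `GL_n(𝔸_K)`
(`CuspidalAutomorphicRepData`, `IsRegularAlgebraic`), every prime `ℓ`, `ι : ℚ̄_ℓ ≃ ℂ`, and every
continuous semisimple `r : Γ_K → GL_n(ℚ̄_ℓ)` with HLTT's characterising property of `r_{ℓ,ι}(π)`
(`HarrisLanTaylorThorne2016.IsCompatible π ι r`, i.e. `r ≅ r_{π,ι}`): at every place `v ∣ ℓ` of `K`,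
`r|_{Γ_{K_v}}` is de Rham (`IsDeRhamFramed`) and, for every continuous embedding
`τ : K_v → ℚ̄_ℓ`, its `τ`-labelled Hodge–Tate weights (`labelledHodgeTateWeightsAt`, computed with
the datum's `ℚ_ℓ`-algebra structure and period ring) are multiplicity-free — the printed weights
being `{λ_{ιτ,1} + (n−1), …, λ_{ιτ,n}}` for the dominant weight `λ` of `π`, hence pairwise distinct.
Weaker than the source (exact weights and the `WD^{ss}` compatibility dropped).
[cite: AHTW2026, Thm. 1.2.1] -/
def deRham_hodgeTateRegular
    (𝓓 : ∀ (K : Type) [Field K] [NumberField K] (p : ℕ) [Fact p.Prime]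
      (v : HeightOneSpectrum (𝓞 K)), ((p : ℕ) : 𝓞 K) ∈ v.asIdeal →
        PstWeilDeligneData (v.adicCompletion K) p) : Prop :=
  ∀ (K : Type) [Field K] [NumberField K], IsCMField K →
    ∀ (n : ℕ), 1 ≤ n →
    ∀ (hcpt : isCompact_glFiniteIntegralLevel n K) (π : CuspidalAutomorphicRepData n K hcpt),
      π.1.IsRegularAlgebraic →
    ∀ (ℓ : ℕ) [Fact ℓ.Prime] (ι : PadicAlgCl ℓ ≃+* ℂ) (r : FramedGaloisRep K (PadicAlgCl ℓ) n),
      r.toGaloisRep.IsSemisimple → HarrisLanTaylorThorne2016.IsCompatible π.1 ι r →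
      ∀ (v : HeightOneSpectrum (𝓞 K)) (hv : ((ℓ : ℕ) : 𝓞 K) ∈ v.asIdeal),
        (𝓓 K ℓ v hv).IsDeRhamFramed (r.toLocal v) ∧
          ∀ τ : v.adicCompletion K →+* PadicAlgCl ℓ, Continuous τ →
            (r.labelledHodgeTateWeightsAt v (𝓓 K ℓ v hv).algebra (𝓓 K ℓ v hv).𝔅 τ).Nodup

/-- Unfolding lemma for `deRham_hodgeTateRegular`. [folklore] -/
theorem deRham_hodgeTateRegular_iff
    (𝓓 : ∀ (K : Type) [Field K] [NumberField K] (p : ℕ) [Fact p.Prime]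
      (v : HeightOneSpectrum (𝓞 K)), ((p : ℕ) : 𝓞 K) ∈ v.asIdeal →
        PstWeilDeligneData (v.adicCompletion K) p) :
    deRham_hodgeTateRegular 𝓓 ↔
      ∀ (K : Type) [Field K] [NumberField K], IsCMField K →
        ∀ (n : ℕ), 1 ≤ n →
        ∀ (hcpt : isCompact_glFiniteIntegralLevel n K) (π : CuspidalAutomorphicRepData n K hcpt),
          π.1.IsRegularAlgebraic →
        ∀ (ℓ : ℕ) [Fact ℓ.Prime] (ι : PadicAlgCl ℓ ≃+* ℂ) (r : FramedGaloisRep K (PadicAlgCl ℓ) n),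
          r.toGaloisRep.IsSemisimple → HarrisLanTaylorThorne2016.IsCompatible π.1 ι r →
          ∀ (v : HeightOneSpectrum (𝓞 K)) (hv : ((ℓ : ℕ) : 𝓞 K) ∈ v.asIdeal),
            (𝓓 K ℓ v hv).IsDeRhamFramed (r.toLocal v) ∧
              ∀ τ : v.adicCompletion K →+* PadicAlgCl ℓ, Continuous τ →
                (r.labelledHodgeTateWeightsAt v (𝓓 K ℓ v hv).algebra (𝓓 K ℓ v hv).𝔅 τ).Nodup :=
  Iff.rfl

/-- **The de Rham clause alone** (projection of `deRham_hodgeTateRegular`): every semisimple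
HLTT-compatible avatar of a regular algebraic cuspidal `π` over a CM field is de Rham at every
`v ∣ ℓ`, relative to the datum. [cite: AHTW2026, Thm. 1.2.1] -/
theorem isDeRhamFramed_of_isCompatible
    {𝓓 : ∀ (K : Type) [Field K] [NumberField K] (p : ℕ) [Fact p.Prime]
      (v : HeightOneSpectrum (𝓞 K)), ((p : ℕ) : 𝓞 K) ∈ v.asIdeal →
        PstWeilDeligneData (v.adicCompletion K) p}
    (h : deRham_hodgeTateRegular 𝓓) {K : Type} [Field K] [NumberField K] (hK : IsCMField K)
    {n : ℕ} (hn : 1 ≤ n) {hcpt : isCompact_glFiniteIntegralLevel n K}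
    (π : CuspidalAutomorphicRepData n K hcpt) (hπ : π.1.IsRegularAlgebraic)
    {ℓ : ℕ} [Fact ℓ.Prime] (ι : PadicAlgCl ℓ ≃+* ℂ) {r : FramedGaloisRep K (PadicAlgCl ℓ) n}
    (hss : r.toGaloisRep.IsSemisimple) (hc : HarrisLanTaylorThorne2016.IsCompatible π.1 ι r)
    (v : HeightOneSpectrum (𝓞 K)) (hv : ((ℓ : ℕ) : 𝓞 K) ∈ v.asIdeal) :
    (𝓓 K ℓ v hv).IsDeRhamFramed (r.toLocal v) :=
  (h K hK n hn hcpt π hπ ℓ ι r hss hc v hv).1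

end AHTW2026

end Literature.NumberTheory.Automorphic
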